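import Literature.Geometry.Lorentzian.OpensChartGeodesicODE
import Literature.Geometry.Lorentzian.ChartCalculus
import Mathlib.Analysis.Calculus.FDeriv.Mul
import Mathlib.Analysis.Calculus.Deriv.Comp
import Mathlib.Analysis.SpecialFunctions.Pow.Real
import HarnessLib

/-!
# Convexity near infinity of a conformally compact metric, coordinate layer

Support file (everything proved, no definitions, no named facts) for the discharge of
`Literature.Geometry.Riemannian.ggsu_boundary_sphere_of_nonTrapping_of_nonpos`
(`SimpleAHBoundarySphere.lean`; Graham–Guillarmou–Stefanov–Uhlmann, Ann. Inst. Fourier 69 (2019),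
p. 3 and p. 10: "the regions `{ρ ≥ ε}` are strictly convex with respect to the flow for `ε > 0`
small enough").

The computation is done in a single chart `U : Opens E` for a metric `g` with components
`G = r⁻² Ḡ` (`r > 0`, `Ḡ` and `r` differentiable; the tree's `OpensChart` calculus): along a
`g`-geodesic `c` with `g(c', c') = 1` the function `f = r ∘ c` satisfies `f'' = D²r(c',c') −
Dr(Γ(c',c'))` (`OpensChart.hasDerivAt_of_isGeodesicOn`), and at a tangency `Dr(c') = 0` the Koszul
formula for the Christoffel map (`OpensChart.two_mul_val_christoffel`) gives
`f'' = D²r(v,v) − r⁻² DḠ(v)(v,Z) + ½ r⁻² DḠ(Z)(v,v) − r⁻¹ Dr(Z)`, `Z = ♯_g dr`, where the first three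
terms are `O(r²)` and the last is `≤ -c₀ r` (Cauchy–Schwarz against a fixed transversal vector `ν`
with `Dr(ν)² ≥ c₀ Ḡ(ν, ν)`); hence `f'' < 0` once `r` is below an explicit threshold
(`second_derivative_neg_of_tangency`).

## References

* C. R. Graham, C. Guillarmou, P. Stefanov, G. Uhlmann, *X-ray transform and boundary rigidity
  for asymptotically hyperbolic manifolds*, Ann. Inst. Fourier 69 (2019), pp. 3, 10 (Lemma 2.3
  and the remark after it). [GrahamEtAl2020]
* B. O'Neill, *Semi-Riemannian geometry* (1983), Ch. 3, Prop. 3.13, Cor. 3.21. [ONeill1983]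
-/

noncomputable section

open Bundle Set Filter Function TopologicalSpace
open scoped Manifold ContDiff Topology

namespace Literature.Geometry.Riemannian

namespace SimpleAH

open Literature.Geometry.Lorentzian
open Literature.Geometry.Lorentzian.PseudoRiemannianMetric
open Literature.Geometry.Lorentzian.OpensChart

set_option maxSynthPendingDepth 3

section Calculus

variable {E : Type*} [NormedAddCommGroup E] [NormedSpace ℝ E]
  {G Gb : E → E →L[ℝ] E →L[ℝ] ℝ} {r : E → ℝ}

/-! ### The derivative of conformally rescaled components `G = r⁻² Ḡ` -/

/-- `d/ds (s²)⁻¹ = -2 s⁻³`. [folklore] -/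
theorem hasDerivAt_inv_sq {s : ℝ} (hs : s ≠ 0) :
    HasDerivAt (fun t : ℝ ↦ (t ^ 2)⁻¹) (-2 * (s ^ 3)⁻¹) s := by
  have h : HasDerivAt (fun t : ℝ ↦ (t ^ 2)⁻¹) (-(((2 : ℕ) : ℝ) * s ^ (2 - 1)) / (s ^ 2) ^ 2) s :=
    (hasDerivAt_pow 2 s).inv (pow_ne_zero 2 hs)
  have e : (-(((2 : ℕ) : ℝ) * s ^ (2 - 1)) / (s ^ 2) ^ 2 : ℝ) = -2 * (s ^ 3)⁻¹ := by
    rw [show (2 : ℕ) - 1 = 1 from rfl, pow_one, Nat.cast_ofNat]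
    field_simp
  rwa [e] at h

/-- Chain rule: `D(r⁻²)(x) = -2 (r x)⁻³ Dr(x)`. [folklore] -/
theorem hasFDerivAt_inv_sq_comp {x : E} (hr : DifferentiableAt ℝ r x) (hrx : r x ≠ 0) :
    HasFDerivAt (fun y ↦ ((r y) ^ 2)⁻¹) ((-2 * ((r x) ^ 3)⁻¹) • fderiv ℝ r x) x :=
  (hasDerivAt_inv_sq hrx).comp_hasFDerivAt x hr.hasFDerivAt

/-- Product rule: if `G = r⁻² Ḡ` with `r x ≠ 0`, then
`DG(x) = r⁻² DḠ(x) + (-2 r⁻³ Dr(x)) ⊗ Ḡ(x)`. [folklore] -/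
theorem hasFDerivAt_conformal {x : E} (hr : DifferentiableAt ℝ r x) (hGb : DifferentiableAt ℝ Gb x)
    (hrx : r x ≠ 0) (hG : ∀ y, G y = ((r y) ^ 2)⁻¹ • Gb y) :
    HasFDerivAt G ((((r x) ^ 2)⁻¹ • fderiv ℝ Gb x) +
      ((-2 * ((r x) ^ 3)⁻¹) • fderiv ℝ r x).smulRight (Gb x)) x := by
  have h := (hasFDerivAt_inv_sq_comp hr hrx).smul hGb.hasFDerivAt
  have hG' : G = fun y ↦ ((r y) ^ 2)⁻¹ • Gb y := funext hG
  rw [hG']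
  exact h

/-- The derivative of conformally rescaled components, applied:
`DG(x)(w)(a, b) = r⁻² DḠ(x)(w)(a, b) - 2 r⁻³ Dr(x)(w) Ḡ(x)(a, b)`. [folklore] -/
theorem fderiv_conformal_apply {x : E} (hr : DifferentiableAt ℝ r x)
    (hGb : DifferentiableAt ℝ Gb x) (hrx : r x ≠ 0) (hG : ∀ y, G y = ((r y) ^ 2)⁻¹ • Gb y)
    (w a b : E) :
    fderiv ℝ G x w a b =
      ((r x) ^ 2)⁻¹ * fderiv ℝ Gb x w a b + (-2 * ((r x) ^ 3)⁻¹ * fderiv ℝ r x w) * Gb x a b := by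
  rw [(hasFDerivAt_conformal hr hGb hrx hG).fderiv]
  simp only [add_apply, smul_apply, ContinuousLinearMap.smulRight_apply, smul_eq_mul]

/-- Conformally rescaled components are differentiable where `r ≠ 0`. [folklore] -/
theorem differentiableAt_conformal {x : E} (hr : DifferentiableAt ℝ r x)
    (hGb : DifferentiableAt ℝ Gb x) (hrx : r x ≠ 0) (hG : ∀ y, G y = ((r y) ^ 2)⁻¹ • Gb y) :
    DifferentiableAt ℝ G x :=
  (hasFDerivAt_conformal hr hGb hrx hG).differentiableAt

/-! ### Elementary inequalities -/

/-- Trilinear operator-norm bound `|T(w)(a)(b)| ≤ ‖T‖ ‖w‖ ‖a‖ ‖b‖`. [folklore] -/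
theorem abs_apply₃_le (T : E →L[ℝ] E →L[ℝ] E →L[ℝ] ℝ) (w a b : E) :
    |T w a b| ≤ ‖T‖ * ‖w‖ * ‖a‖ * ‖b‖ := by
  have h1 : ‖T w a b‖ ≤ ‖T w a‖ * ‖b‖ := (T w a).le_opNorm b
  have h2 : ‖T w a‖ ≤ ‖T w‖ * ‖a‖ := (T w).le_opNorm a
  have h3 : ‖T w‖ ≤ ‖T‖ * ‖w‖ := T.le_opNorm w
  rw [← Real.norm_eq_abs]
  calc ‖T w a b‖ ≤ ‖T w a‖ * ‖b‖ := h1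
    _ ≤ ‖T w‖ * ‖a‖ * ‖b‖ := by gcongr
    _ ≤ ‖T‖ * ‖w‖ * ‖a‖ * ‖b‖ := by gcongr

/-- **Cauchy–Schwarz** for a positive semidefinite symmetric bilinear form:
`B(a, b)² ≤ B(a, a) B(b, b)`. [folklore] -/
theorem sq_le_mul_of_psd {V : Type*} [AddCommGroup V] [Module ℝ V] (B : V →ₗ[ℝ] V →ₗ[ℝ] ℝ)
    (hsymm : ∀ a b, B a b = B b a) (hpos : ∀ a, 0 ≤ B a a) (a b : V) :
    (B a b) ^ 2 ≤ B a a * B b b := by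
  have hquad : ∀ t : ℝ, 0 ≤ B b b * (t * t) + (-(2 * B a b)) * t + B a a := by
    intro t
    have h := hpos (a - t • b)
    have hexp : B (a - t • b) (a - t • b) = B b b * (t * t) + (-(2 * B a b)) * t + B a a := by
      simp only [map_sub, map_smul, LinearMap.sub_apply, LinearMap.smul_apply, smul_eq_mul,
        hsymm b a]
      ring
    linarith
  by_cases hb : B b b = 0
  · -- then `B a b = 0`
    have hab : B a b = 0 := by
      by_contra h
      have h1 := hquad ((B a a + 1) / (2 * B a b))
      rw [hb] at h1
      have h2 : -(2 * B a b) * ((B a a + 1) / (2 * B a b)) = -(B a a + 1) := by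
        field_simp
      rw [h2] at h1
      linarith [hpos a]
    rw [hab, hb]
    simp
  · have hbpos : 0 < B b b := lt_of_le_of_ne (hpos b) (Ne.symm hb)
    have h := discrim_le_zero hquad
    simp only [discrim] at h
    nlinarith [h, hbpos]

/-- The real-variable core of the convexity estimate: with `‖v‖² ≤ ρ²/m`, `‖Z‖ ≤ C_r ρ²/m`,
`|q₁| ≤ C₂ ‖v‖²`, `|q₂| ≤ C₁ ‖v‖² ‖Z‖`, `|q₃| ≤ C₁ ‖Z‖ ‖v‖²`, `d ≥ c₀ ρ²` and
`ρ < c₀ m / (C₂ + 2 C₁ C_r / m + 1)`, one has `q₁ − ρ⁻² q₂ + ½ ρ⁻² q₃ − ρ⁻¹ d < 0`. [folklore] -/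
theorem convexity_real_ineq {ρ m C₁ C₂ Cr c₀ nv nZ q₁ q₂ q₃ d : ℝ} (hρ : 0 < ρ) (hm : 0 < m)
    (hC₁ : 0 ≤ C₁) (hC₂ : 0 ≤ C₂) (hCr : 0 ≤ Cr) (hc₀ : 0 < c₀) (hnZ : 0 ≤ nZ)
    (hv : nv ^ 2 ≤ ρ ^ 2 / m) (hZ : nZ ≤ Cr * ρ ^ 2 / m) (h1 : |q₁| ≤ C₂ * nv ^ 2)
    (h2 : |q₂| ≤ C₁ * nv ^ 2 * nZ) (h3 : |q₃| ≤ C₁ * nZ * nv ^ 2) (hd : c₀ * ρ ^ 2 ≤ d)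
    (hsmall : ρ < c₀ * m / (C₂ + 2 * C₁ * Cr / m + 1)) :
    q₁ - (ρ ^ 2)⁻¹ * q₂ + 2⁻¹ * ((ρ ^ 2)⁻¹ * q₃) - ρ⁻¹ * d < 0 := by
  have hρ2 : 0 < ρ ^ 2 := by positivity
  have hi : 0 ≤ (ρ ^ 2)⁻¹ := inv_nonneg.2 hρ2.le
  -- bounds on the four terms
  have hb1 : q₁ ≤ C₂ * (ρ ^ 2 / m) :=
    (le_abs_self _).trans (h1.trans (mul_le_mul_of_nonneg_left hv hC₂))
  have hvZ : nv ^ 2 * nZ ≤ (ρ ^ 2 / m) * (Cr * ρ ^ 2 / m) :=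
    mul_le_mul hv hZ hnZ (div_nonneg hρ2.le hm.le)
  have hb2 : -((ρ ^ 2)⁻¹ * q₂) ≤ C₁ * Cr * ρ ^ 2 / m ^ 2 := by
    have h4 : -q₂ ≤ C₁ * ((ρ ^ 2 / m) * (Cr * ρ ^ 2 / m)) := by
      have := neg_abs_le q₂
      have h5 : C₁ * nv ^ 2 * nZ ≤ C₁ * ((ρ ^ 2 / m) * (Cr * ρ ^ 2 / m)) := by
        rw [mul_assoc]
        exact mul_le_mul_of_nonneg_left hvZ hC₁
      linarith
    calc -((ρ ^ 2)⁻¹ * q₂) = (ρ ^ 2)⁻¹ * (-q₂) := by ring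
      _ ≤ (ρ ^ 2)⁻¹ * (C₁ * ((ρ ^ 2 / m) * (Cr * ρ ^ 2 / m))) := mul_le_mul_of_nonneg_left h4 hi
      _ = C₁ * Cr * ρ ^ 2 / m ^ 2 := by field_simp
  have hb3 : 2⁻¹ * ((ρ ^ 2)⁻¹ * q₃) ≤ 2⁻¹ * (C₁ * Cr * ρ ^ 2 / m ^ 2) := by
    have h4 : q₃ ≤ C₁ * ((ρ ^ 2 / m) * (Cr * ρ ^ 2 / m)) := by
      have h5 : C₁ * nZ * nv ^ 2 ≤ C₁ * ((ρ ^ 2 / m) * (Cr * ρ ^ 2 / m)) := by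
        rw [mul_assoc, mul_comm nZ]
        exact mul_le_mul_of_nonneg_left hvZ hC₁
      linarith [le_abs_self q₃]
    have h6 : (ρ ^ 2)⁻¹ * q₃ ≤ C₁ * Cr * ρ ^ 2 / m ^ 2 := by
      calc (ρ ^ 2)⁻¹ * q₃ ≤ (ρ ^ 2)⁻¹ * (C₁ * ((ρ ^ 2 / m) * (Cr * ρ ^ 2 / m))) :=
            mul_le_mul_of_nonneg_left h4 hi
        _ = C₁ * Cr * ρ ^ 2 / m ^ 2 := by field_simp
    linarith
  have hb4 : -(ρ⁻¹ * d) ≤ -(c₀ * ρ) := by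
    have h4 : c₀ * ρ ≤ ρ⁻¹ * d := by
      rw [le_inv_mul_iff₀ hρ]
      calc ρ * (c₀ * ρ) = c₀ * ρ ^ 2 := by ring
        _ ≤ d := hd
    linarith
  -- the threshold
  have hD : 0 < C₂ + 2 * C₁ * Cr / m + 1 := by positivity
  have hsmall' : (C₂ + 2 * C₁ * Cr / m + 1) * ρ < c₀ * m := by
    rwa [lt_div_iff₀ hD, mul_comm] at hsmall
  have hkey : C₂ * (ρ ^ 2 / m) + C₁ * Cr * ρ ^ 2 / m ^ 2 + 2⁻¹ * (C₁ * Cr * ρ ^ 2 / m ^ 2)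
      < c₀ * ρ := by
    have e1 : C₂ * (ρ ^ 2 / m) + C₁ * Cr * ρ ^ 2 / m ^ 2 + 2⁻¹ * (C₁ * Cr * ρ ^ 2 / m ^ 2)
        = (C₂ + (3 / 2) * (C₁ * Cr / m)) * ρ * (ρ / m) := by
      field_simp
      ring
    have hle : C₂ + (3 / 2) * (C₁ * Cr / m) ≤ C₂ + 2 * C₁ * Cr / m + 1 := by
      have ht : 0 ≤ C₁ * Cr / m := by positivity
      have e2 : 2 * C₁ * Cr / m = 2 * (C₁ * Cr / m) := by ring
      rw [e2]
      linarith
    have h5 : (C₂ + (3 / 2) * (C₁ * Cr / m)) * ρ * (ρ / m)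
        ≤ (C₂ + 2 * C₁ * Cr / m + 1) * ρ * (ρ / m) := by
      have hρm : 0 ≤ ρ / m := div_nonneg hρ.le hm.le
      gcongr
    have h6 : (C₂ + 2 * C₁ * Cr / m + 1) * ρ * (ρ / m) < c₀ * m * (ρ / m) :=
      mul_lt_mul_of_pos_right hsmall' (div_pos hρ hm)
    have h7 : c₀ * m * (ρ / m) = c₀ * ρ := by field_simp
    linarith
  linarith

end Calculus

/-! ### The sign of `f''` at a tangency: the pointwise estimate -/

section Pointwise

variable {E : Type*} [NormedAddCommGroup E] [NormedSpace ℝ E] [FiniteDimensional ℝ E]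
  {U : Opens E} {n : ℕ∞ω}
  {g : PseudoRiemannianMetric 𝓘(ℝ, E) n E (TangentSpace 𝓘(ℝ, E) : U → Type _)}
  {G Gb : E → E →L[ℝ] E →L[ℝ] ℝ} {r : E → ℝ}

/-- **Pointwise convexity estimate.** At `x ∈ U` let `g_x = G x`, `G = r⁻² Ḡ` near `x` with
`r x > 0`, `Ḡ` symmetric, `m ‖w‖² ≤ Ḡ_x(w, w)`, `‖DḠ(x)‖ ≤ C₁`, `‖D²r(x)‖ ≤ C₂`, `‖Dr(x)‖ ≤ C_r`,
and a vector `ν` with `Ḡ_x(ν,ν) > 0` and `c₀ Ḡ_x(ν, ν) ≤ Dr_x(ν)²`. If `v` is a `g`-unit vector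
tangent to the level set of `r` (`G x v v = 1`, `Dr_x(v) = 0`) and
`r x < c₀ m / (C₂ + 2 C₁ C_r / m + 1)`, then `D²r_x(v, v) − Dr_x(Γ_x(v, v)) < 0`, `Γ` the Christoffel
map of the components (`OpensChart.christoffel`). By the Koszul formula this quantity equals
`D²r(v,v) − r⁻² DḠ(v)(v,Z) + ½ r⁻² DḠ(Z)(v,v) − r⁻¹ Dr(Z)`, `Z = ♯_g dr`, whose first three terms are
`O(r²)` and whose last term is `≤ -c₀ r` (Cauchy–Schwarz). It is the value of `(r ∘ c)''` at a
tangency of a `g`-geodesic `c` with a level set of `r` (GGSU 2019, p. 10: the regions `{ρ ≥ ε}`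
are strictly convex for small `ε`). [cite: GrahamEtAl2020, p. 10] -/
theorem hessTerm_sub_christoffel_neg (hG : ∀ y : U, g.val y = G y) (x : U)
    (hr : DifferentiableAt ℝ r x) (hGb : DifferentiableAt ℝ Gb x)
    (hconf : ∀ y, G y = ((r y) ^ 2)⁻¹ • Gb y) (hrx : 0 < r x)
    (hsymm : ∀ (y : E) (a b : E), Gb y a b = Gb y b a)
    {m C₁ C₂ Cr c₀ : ℝ} (hm : 0 < m) (hmG : ∀ w : E, m * ‖w‖ ^ 2 ≤ Gb x w w)
    (hC₁ : ‖fderiv ℝ Gb x‖ ≤ C₁) (hC₂ : ‖fderiv ℝ (fderiv ℝ r) x‖ ≤ C₂) (hCr : ‖fderiv ℝ r x‖ ≤ Cr)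
    (hc₀ : 0 < c₀) {ν : E} (hν : 0 < Gb x ν ν) (hνc : c₀ * Gb x ν ν ≤ (fderiv ℝ r x ν) ^ 2)
    {v : E} (hv : G x v v = 1) (htan : fderiv ℝ r x v = 0)
    (hsmall : r x < c₀ * m / (C₂ + 2 * C₁ * Cr / m + 1)) :
    fderiv ℝ (fderiv ℝ r) x v v - fderiv ℝ r x (christoffel g G x v v) < 0 := by
  -- abbreviations
  set ρ : ℝ := r x with hρ
  set Dr : E →L[ℝ] ℝ := fderiv ℝ r x with hDr
  set D2r : E →L[ℝ] E →L[ℝ] ℝ := fderiv ℝ (fderiv ℝ r) x with hD2r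
  set DGb : E →L[ℝ] E →L[ℝ] E →L[ℝ] ℝ := fderiv ℝ Gb x with hDGb
  have hρ0 : ρ ≠ 0 := hrx.ne'
  have hC₁0 : 0 ≤ C₁ := (norm_nonneg _).trans hC₁
  have hC₂0 : 0 ≤ C₂ := (norm_nonneg _).trans hC₂
  have hCr0 : 0 ≤ Cr := (norm_nonneg _).trans hCr
  -- `G x = ρ⁻² Ḡ x`, positivity
  have hGx : G x = (ρ ^ 2)⁻¹ • Gb x := hconf x
  have hGxa : ∀ a b : E, G x a b = (ρ ^ 2)⁻¹ * Gb x a b := fun a b ↦ by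
    rw [hGx]; rfl
  have hgval : ∀ a b : E, g.val x a b = G x a b := fun a b ↦
    congrArg (fun B : E →L[ℝ] E →L[ℝ] ℝ ↦ B a b) (hG x)
  have hGnn : ∀ a : E, 0 ≤ Gb x a a := fun a ↦
    le_trans (mul_nonneg hm.le (sq_nonneg _)) (hmG a)
  have hgnn : ∀ a : E, 0 ≤ g.val x a a := fun a ↦ by
    rw [hgval, hGxa]
    exact mul_nonneg (inv_nonneg.2 (sq_nonneg _)) (hGnn a)
  -- `Ḡ(v, v) = ρ²` and `‖v‖² ≤ ρ² / m`
  have hvv : Gb x v v = ρ ^ 2 := by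
    have h := hGxa v v
    rw [hv] at h
    field_simp at h
    linarith
  have hvn : ‖v‖ ^ 2 ≤ ρ ^ 2 / m := by
    rw [le_div_iff₀ hm]
    have := hmG v
    rw [hvv] at this
    linarith
  -- the vector `Z = ♯ dr`: `g_x(Z, W) = Dr(W)`
  set Z : E := g.sharp x Dr.toLinearMap with hZ
  have hZval : ∀ W : E, g.val x Z W = Dr W := fun W ↦ g.val_sharp_apply x Dr.toLinearMap W
  have hZval' : ∀ W : E, g.val x W Z = Dr W := fun W ↦ by rw [g.symm]; exact hZval W
  have hDrZ_eq : Dr Z = (ρ ^ 2)⁻¹ * Gb x Z Z := by rw [← hZval Z, hgval, hGxa]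
  have hDrZ_nn : 0 ≤ Dr Z := by rw [← hZval Z]; exact hgnn Z
  -- `‖Z‖ ≤ C_r ρ² / m`
  have hZn : ‖Z‖ ≤ Cr * ρ ^ 2 / m := by
    have h1 : (ρ ^ 2)⁻¹ * (m * ‖Z‖ ^ 2) ≤ Cr * ‖Z‖ := by
      calc (ρ ^ 2)⁻¹ * (m * ‖Z‖ ^ 2) ≤ (ρ ^ 2)⁻¹ * Gb x Z Z :=
            mul_le_mul_of_nonneg_left (hmG Z) (inv_nonneg.2 (sq_nonneg _))
        _ = Dr Z := hDrZ_eq.symm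
        _ ≤ ‖Dr Z‖ := Real.le_norm_self _
        _ ≤ ‖Dr‖ * ‖Z‖ := Dr.le_opNorm Z
        _ ≤ Cr * ‖Z‖ := mul_le_mul_of_nonneg_right hCr (norm_nonneg _)
    by_cases hZ0 : ‖Z‖ = 0
    · rw [hZ0]; positivity
    · have hZpos : 0 < ‖Z‖ := lt_of_le_of_ne (norm_nonneg _) (Ne.symm hZ0)
      have hρ2 : 0 < ρ ^ 2 := by positivity
      rw [le_div_iff₀ hm]
      have h2 : (ρ ^ 2)⁻¹ * (m * ‖Z‖ ^ 2) * ρ ^ 2 ≤ Cr * ‖Z‖ * ρ ^ 2 :=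
        mul_le_mul_of_nonneg_right h1 hρ2.le
      have h3 : (ρ ^ 2)⁻¹ * (m * ‖Z‖ ^ 2) * ρ ^ 2 = m * ‖Z‖ * ‖Z‖ := by
        field_simp
      rw [h3] at h2
      have h4 : m * ‖Z‖ ≤ Cr * ρ ^ 2 := le_of_mul_le_mul_right (by linarith) hZpos
      linarith
  -- `Dr(Z) ≥ c₀ ρ²` (Cauchy–Schwarz against `ν`)
  have hDrZ : c₀ * ρ ^ 2 ≤ Dr Z := by
    have hcs := sq_le_mul_of_psd (g.val x).toLinearMap₁₂ (fun a b ↦ g.symm x a b) hgnn Z ν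
    simp only [ContinuousLinearMap.toLinearMap₁₂_apply] at hcs
    rw [hZval ν, hZval Z, hgval ν ν, hGxa] at hcs
    -- `(Dr ν)² ≤ Dr Z * (ρ⁻² Ḡ(ν,ν))`, and `c₀ Ḡ(ν,ν) ≤ (Dr ν)²`
    have h1 : c₀ * Gb x ν ν ≤ Dr Z * ((ρ ^ 2)⁻¹ * Gb x ν ν) := hνc.trans hcs
    have h2 : c₀ * Gb x ν ν * ρ ^ 2 ≤ Dr Z * Gb x ν ν := by
      have := mul_le_mul_of_nonneg_right h1 (sq_nonneg ρ)
      calc c₀ * Gb x ν ν * ρ ^ 2 ≤ Dr Z * ((ρ ^ 2)⁻¹ * Gb x ν ν) * ρ ^ 2 := this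
        _ = Dr Z * Gb x ν ν := by field_simp
    nlinarith
  -- the derivative of the components: `DG(w)(a,b) = ρ⁻² DḠ(w)(a,b) − 2 ρ⁻³ Dr(w) Ḡ(a,b)`
  have hDG : ∀ w a b : E, fderiv ℝ G x w a b =
      (ρ ^ 2)⁻¹ * DGb w a b + (-2 * (ρ ^ 3)⁻¹ * Dr w) * Gb x a b := fun w a b ↦
    fderiv_conformal_apply hr hGb hρ0 hconf w a b
  have hGdiff : DifferentiableAt ℝ G x := differentiableAt_conformal hr hGb hρ0 hconf
  -- Koszul: `Dr(Γ(v,v)) = g(Γ(v,v), Z) = DG(v)(v,Z) − ½ DG(Z)(v,v)`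
  have hkosz : Dr (christoffel g G x v v) =
      fderiv ℝ G x v v Z - 2⁻¹ * fderiv ℝ G x Z v v := by
    have h := two_mul_val_christoffel (g := g) (G := G) x v v Z
    rw [hZval', koszulForm_apply] at h
    have hGs : ∀ (y : E) (A B : E), G y A B = G y B A := fun y A B ↦ by
      rw [hconf y]
      show ((r y) ^ 2)⁻¹ * Gb y A B = ((r y) ^ 2)⁻¹ * Gb y B A
      rw [hsymm y A B]
    rw [fderiv_apply₂_symm hGs hGdiff v Z v] at h
    linarith
  -- assemble
  have hQ : D2r v v - Dr (christoffel g G x v v) =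
      D2r v v - (ρ ^ 2)⁻¹ * DGb v v Z + 2⁻¹ * ((ρ ^ 2)⁻¹ * DGb Z v v) - ρ⁻¹ * Dr Z := by
    rw [hkosz, hDG, hDG, htan, hvv]
    have e3 : (ρ ^ 3)⁻¹ * ρ ^ 2 = ρ⁻¹ := by field_simp
    linear_combination (-(Dr Z)) * e3
  rw [hQ]
  have hq1 : |D2r v v| ≤ C₂ * ‖v‖ ^ 2 := by
    calc |D2r v v| ≤ ‖D2r‖ * ‖v‖ * ‖v‖ := by
          rw [← Real.norm_eq_abs]
          exact D2r.le_opNorm₂ v v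
      _ ≤ C₂ * ‖v‖ * ‖v‖ := by gcongr
      _ = C₂ * ‖v‖ ^ 2 := by ring
  have hq2 : |DGb v v Z| ≤ C₁ * ‖v‖ ^ 2 * ‖Z‖ := by
    calc |DGb v v Z| ≤ ‖DGb‖ * ‖v‖ * ‖v‖ * ‖Z‖ := abs_apply₃_le DGb v v Z
      _ ≤ C₁ * ‖v‖ * ‖v‖ * ‖Z‖ := by gcongr
      _ = C₁ * ‖v‖ ^ 2 * ‖Z‖ := by ring
  have hq3 : |DGb Z v v| ≤ C₁ * ‖Z‖ * ‖v‖ ^ 2 := by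
    calc |DGb Z v v| ≤ ‖DGb‖ * ‖Z‖ * ‖v‖ * ‖v‖ := abs_apply₃_le DGb Z v v
      _ ≤ C₁ * ‖Z‖ * ‖v‖ * ‖v‖ := by gcongr
      _ = C₁ * ‖Z‖ * ‖v‖ ^ 2 := by ring
  exact convexity_real_ineq hrx hm hC₁0 hC₂0 hCr0 hc₀ (norm_nonneg Z)
    hvn hZn hq1 hq2 hq3 hDrZ hsmall

/-! ### The second derivative of `r` along a geodesic, in the chart -/

/-- **`(r ∘ c)'' = D²r(c', c') − Dr(Γ(c', c'))` along a geodesic in a chart.** Let `γ : ℝ → U` be a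
geodesic of `g.leviCivita` on an open set `s ∋ t` (components `G`, differentiable on `U`), and let
`r : E → ℝ` be differentiable near `γ t` with `Dr` differentiable at `γ t`. Then near `t` the
function `f = r ∘ γ` has derivative `f'(t') = Dr_{γ t'}(γ' t')`, and `f'` has derivative
`D²r(γ', γ') − Dr(Γ(γ', γ'))` at `t` (chain rule and the coordinate geodesic equation
`(γ')' = -Γ(γ', γ')`, `OpensChart.hasDerivAt_of_isGeodesicOn`; O'Neill 1983, Ch. 3, Cor. 21).
[cite: ONeill1983, Ch. 3, Cor. 3.21] -/
theorem hasDerivAt_deriv_comp_geodesic [CompleteSpace E] [Fact (1 ≤ n)] [g.HasLeviCivita]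
    (hG : ∀ y : U, g.val y = G y) (hGd : ∀ y : U, DifferentiableAt ℝ G y) {γ : ℝ → U} {s : Set ℝ}
    (hs : IsOpen s) (hγ : IsGeodesicOn g.leviCivita γ s) {t : ℝ} (ht : t ∈ s)
    (hr : ∀ᶠ y in 𝓝 (γ t : E), DifferentiableAt ℝ r y)
    (hr2 : DifferentiableAt ℝ (fderiv ℝ r) (γ t : E)) :
    (∀ᶠ t' in 𝓝 t, HasDerivAt (fun t'' ↦ r (γ t''))
      (fderiv ℝ r (γ t') (velocity 𝓘(ℝ, E) γ t')) t') ∧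
    HasDerivAt (fun t' ↦ fderiv ℝ r (γ t') (velocity 𝓘(ℝ, E) γ t'))
      (fderiv ℝ (fderiv ℝ r) (γ t) (velocity 𝓘(ℝ, E) γ t) (velocity 𝓘(ℝ, E) γ t) -
        fderiv ℝ r (γ t) (christoffel g G (γ t) (velocity 𝓘(ℝ, E) γ t) (velocity 𝓘(ℝ, E) γ t)))
      t := by
  have hpos := hasDerivAt_of_isGeodesicOn hG hGd hγ ht
  -- continuity of the coordinate curve at `t`
  have hcont : ContinuousAt (fun t' ↦ (γ t' : E)) t := hpos.1.continuousAt
  have hr' : ∀ᶠ t' in 𝓝 t, DifferentiableAt ℝ r (γ t' : E) := hcont.eventually hr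
  have hs' : ∀ᶠ t' in 𝓝 t, t' ∈ s := hs.mem_nhds ht
  refine ⟨?_, ?_⟩
  · filter_upwards [hr', hs'] with t' hrt' hst'
    have h1 := (hasDerivAt_of_isGeodesicOn hG hGd hγ hst').1
    exact hrt'.hasFDerivAt.comp_hasDerivAt t' h1
  · have hA : HasDerivAt (fun t' ↦ fderiv ℝ r (γ t' : E))
        (fderiv ℝ (fderiv ℝ r) (γ t) (velocity 𝓘(ℝ, E) γ t)) t :=
      hr2.hasFDerivAt.comp_hasDerivAt t hpos.1
    have h := hA.clm_apply hpos.2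
    simpa only [map_neg, sub_eq_add_neg] using h

omit [FiniteDimensional ℝ E] in
/-- If `f` has derivative `φ t'` at every `t'` near `t` and `φ` has derivative `a` at `t`, then
`deriv f = φ` near `t` and `deriv (deriv f) t = a`. [folklore] -/
theorem deriv_deriv_eq_of_eventually {f φ : ℝ → ℝ} {t a : ℝ}
    (h1 : ∀ᶠ t' in 𝓝 t, HasDerivAt f (φ t') t') (h2 : HasDerivAt φ a t) :
    deriv f t = φ t ∧ deriv (deriv f) t = a := by
  have heq : deriv f =ᶠ[𝓝 t] φ := by
    filter_upwards [h1] with t' ht'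
    exact ht'.deriv
  refine ⟨heq.self_of_nhds, ?_⟩
  rw [heq.deriv_eq]
  exact h2.deriv

/-- **Convexity of the level sets of `r` near `r = 0`, in a chart** (GGSU 2019, p. 10: "the regions
`{ρ ≥ ε}` are strictly convex with respect to the flow for `ε > 0` small enough"). In the setting of
`hessTerm_sub_christoffel_neg` (metric `g` on `U : Opens E` with components `G = r⁻² Ḡ`, bounds
`m, C₁, C₂, C_r, c₀, ν` at the point), let `γ` be a geodesic of `g` on an open `s ∋ t` with
`g(γ' t, γ' t) = 1`, `r` differentiable near `γ t` and `Dr` differentiable at `γ t`. If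
`f = r ∘ γ` has `f'(t) = 0` and `r (γ t) < c₀ m / (C₂ + 2 C₁ C_r / m + 1)`, then `f''(t) < 0`.
[cite: GrahamEtAl2020, p. 10] -/
theorem deriv_deriv_comp_geodesic_neg [CompleteSpace E] [Fact (1 ≤ n)] [g.HasLeviCivita]
    (hG : ∀ y : U, g.val y = G y) (hGd : ∀ y : U, DifferentiableAt ℝ G y) {γ : ℝ → U} {s : Set ℝ}
    (hs : IsOpen s) (hγ : IsGeodesicOn g.leviCivita γ s) {t : ℝ} (ht : t ∈ s)
    (hr : ∀ᶠ y in 𝓝 (γ t : E), DifferentiableAt ℝ r y)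
    (hr2 : DifferentiableAt ℝ (fderiv ℝ r) (γ t : E)) (hGb : DifferentiableAt ℝ Gb (γ t : E))
    (hconf : ∀ y, G y = ((r y) ^ 2)⁻¹ • Gb y) (hrx : 0 < r (γ t))
    (hsymm : ∀ (y : E) (a b : E), Gb y a b = Gb y b a)
    {m C₁ C₂ Cr c₀ : ℝ} (hm : 0 < m) (hmG : ∀ w : E, m * ‖w‖ ^ 2 ≤ Gb (γ t) w w)
    (hC₁ : ‖fderiv ℝ Gb (γ t)‖ ≤ C₁) (hC₂ : ‖fderiv ℝ (fderiv ℝ r) (γ t)‖ ≤ C₂)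
    (hCr : ‖fderiv ℝ r (γ t)‖ ≤ Cr) (hc₀ : 0 < c₀) {ν : E} (hν : 0 < Gb (γ t) ν ν)
    (hνc : c₀ * Gb (γ t) ν ν ≤ (fderiv ℝ r (γ t) ν) ^ 2)
    (hunit : G (γ t) (velocity 𝓘(ℝ, E) γ t) (velocity 𝓘(ℝ, E) γ t) = 1)
    (htan : deriv (fun t' ↦ r (γ t')) t = 0)
    (hsmall : r (γ t) < c₀ * m / (C₂ + 2 * C₁ * Cr / m + 1)) :
    deriv (deriv fun t' ↦ r (γ t')) t < 0 := by
  obtain ⟨h1, h2⟩ := hasDerivAt_deriv_comp_geodesic hG hGd hs hγ ht hr hr2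
  obtain ⟨hd1, hd2⟩ := deriv_deriv_eq_of_eventually h1 h2
  rw [hd2]
  rw [hd1] at htan
  exact hessTerm_sub_christoffel_neg hG (γ t) hr.self_of_nhds hGb hconf hrx hsymm hm hmG hC₁ hC₂
    hCr hc₀ hν hνc hunit htan hsmall

end Pointwise

end SimpleAH

end Literature.Geometry.Riemannian

end
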